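import Summits.NavierStokesRegularity.NavierStokesRegularity.Theorems.ScenarioCensusRowF7vtHotSpot
import HarnessLib

/-!
# Census row F7vt (uniformly vanishing top) — part 2/2: the hot ball, scale invariance of the top mass,
# hot-spot saturation, the headline theorems and the census keys

Part 2 of the re-homing (VERBATIM port, namespace adapted) of ns-idea-3's LINE 7 «vanishing-top»
(`line-vanishing-top.lean`, sha16 `4908090d8b1f630c`); provenance and the statements in part 1
(`ScenarioCensusRowF7vtHotSpot.lean`).  Here: §3b the hot ball (one gradient bound for all unit zooms,
KNSS 2009 Prop. 4.1 = tree `exists_norm_iteratedFDeriv_le_of_bounded`), §3c the scale invariance of the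
top mass (Lebesgue scaling `Measure.addHaar_preimage_smul`), §3d `hotSpotSaturation_holds`, §4 the
headlines `rowF7vt_holds : Row_F7vt`, `topTameness_iff_rowF7 : TopTameness ↔ Row_F7`,
`rowF7_of_topTameness`; and the census keys in namespace `…Theorems.ScenarioCensus`:
`Row_F7vt` (BY NAME the line's Prop), `row_F7vt_excluded`, `TopTameness`, `row_F7_iff_topTameness`.

Values are booked by the census lead, not by this file; NS regularity is NOT proved; no summit statement
is proved by this file.

## References

* G. Koch, N. Nadirashvili, G. Seregin, V. Šverák, Acta Math. 203 (2009) = arXiv:0709.3599, §4 (4.10),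
  Prop. 4.1 (4.6). [KochNadirashviliSereginSverak2009]
-/

set_option linter.dupNamespace false

noncomputable section

open MeasureTheory Set Filter Topology Function Metric
open scoped ENNReal NNReal

namespace Summit.NavierStokesRegularity.NavierStokesRegularity.Theorems.ScenarioCensus.VanishingTop

open Literature.Analysis Literature.Analysis.FluidPDE Literature.Analysis.FunctionSpaces
open Summit.NavierStokesRegularity.NavierStokesRegularity.Theorems.ScenarioCensus (Row_F7)
open Summit.NavierStokesRegularity.NavierStokesRegularity.Theorems.TypeIliouvilleNoTypeII.ImmortalZoom
open Summit.NavierStokesRegularity.NavierStokesRegularity.Theorems.TypeIliouvilleNoTypeII.TypeIIZoom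

/-! ### §3b The hot ball: a uniform gradient bound for the unit zoom (KNSS 2009, Prop. 4.1) -/

section HotBall

open Literature.Analysis.UnboundedOperators

/-- **Uniform hot-ball radius.**  For `A ≥ 1`, `K₀ > 0` there is `δ = δ(A, K₀) > 0` such that for every
Clay solution and every sup-controlled value-active window (`|u| ≤ A·M` on `[t₀ ± K₀ν/M²] ⊆ (0, T)`,
`M ≤ 2|u(t₀,x₀)|`) the zoom of amplitude `(AM)⁻¹` centred at `(t₀, x₀)` exceeds `1/(4A)` in norm on the
ball of radius `δ` at rescaled time `0`: the zoom is a unit-viscosity Oseen-mild field bounded by `1` on the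
rescaled window `(-K₀A², K₀A²)`, so ALL such zooms obey ONE gradient bound at time `0`
(`exists_norm_iteratedFDeriv_le_of_bounded`), while `|w(0,0)| ≥ 1/(2A)`. [cite: KochNadirashviliSereginSverak2009, §4 (4.10) with Prop. 4.1 (4.6) (arXiv:0709.3599v1 p. 8)] -/
theorem exists_hotBall_radius {A K₀ : ℝ} (hA : 1 ≤ A) (hK₀ : 0 < K₀) :
    ∃ δ : ℝ, 0 < δ ∧ ∀ ⦃ν T M t₀ : ℝ⦄ ⦃u : ℝ → E3 → E3⦄ ⦃p : ℝ → E3 → ℝ⦄ ⦃x₀ : E3⦄,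
      0 < ν → 0 < T → IsClassicalNSSolutionOn (Ico 0 T) ν 0 u p → IsLerayHopfOn T ν 0 (u 0) u →
      HasRapidSpatialDecay (u 0) → 0 < M →
      Icc (t₀ - K₀ * ν / M ^ 2) (t₀ + K₀ * ν / M ^ 2) ⊆ Ioo 0 T →
      (∀ s ∈ Icc (t₀ - K₀ * ν / M ^ 2) (t₀ + K₀ * ν / M ^ 2), ∀ x, ‖u s x‖ ≤ A * M) →
      M ≤ 2 * ‖u t₀ x₀‖ →
      ball (0 : E3) δ ⊆
        {y | 1 / (4 * A) < ‖((A * M)⁻¹ • stPull (ν / (A * M) ^ 2) (ν / (A * M)) t₀ x₀ u) 0 y‖} := by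
  obtain ⟨K, hK⟩ := exists_norm_iteratedFDeriv_le_of_bounded (1 : ℝ) 1 (a := -(K₀ / 2)) (b := K₀ / 2)
    (δ := K₀ / 4) (by linarith) (by positivity)
  set K' : ℝ := max K 0 with hK'def
  have hK'0 : 0 ≤ K' := le_max_right _ _
  have hA0 : 0 < A := one_pos.trans_le hA
  set δ : ℝ := 1 / (4 * A * (K' + 1)) with hδdef
  have hδ : 0 < δ := by positivity
  refine ⟨δ, hδ, ?_⟩
  intro ν T M t₀ u p x₀ hν hT hsol hLH hdec hM hsub hbd hact y hy
  set M' : ℝ := A * M with hM'def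
  have hM' : 0 < M' := by positivity
  -- the window in `M'` units: half-length `K₀ν/M² = (K₀A²)ν/M'²`
  have hKe : K₀ * ν / M ^ 2 = K₀ * A ^ 2 * ν / M' ^ 2 := by
    rw [hM'def]; field_simp
  have hKA : K₀ ≤ K₀ * A ^ 2 := by
    have : 1 ≤ A ^ 2 := by nlinarith
    nlinarith
  have hsub' : Icc (t₀ - K₀ * A ^ 2 * ν / M' ^ 2) (t₀ + K₀ * A ^ 2 * ν / M' ^ 2) ⊆ Ioo 0 T := by
    rw [← hKe]; exact hsub
  have hbd' : ∀ s ∈ Icc (t₀ - K₀ * A ^ 2 * ν / M' ^ 2) (t₀ + K₀ * A ^ 2 * ν / M' ^ 2), ∀ x,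
      ‖u s x‖ ≤ M' := by
    rw [← hKe]; exact hbd
  set w : ℝ → E3 → E3 := M'⁻¹ • stPull (ν / M' ^ 2) (ν / M') t₀ x₀ u with hwdef
  -- the zoom is a bounded continuous Oseen-mild field on the rescaled window
  have hc : ContinuousOn (uncurry w) (Ioo (-(K₀ * A ^ 2)) (K₀ * A ^ 2) ×ˢ univ) :=
    windowZoom_continuousOn (x₀ := x₀) hν hsol hM' hsub'
  have hdiv : ∀ s ∈ Ioo (-(K₀ * A ^ 2)) (K₀ * A ^ 2), IsWeaklyDivFree (w s) := fun s hs =>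
    windowZoom_isWeaklyDivFree (x₀ := x₀) hν hsol hM' hsub' hs
  have hmild : ∀ s t : ℝ, -(K₀ * A ^ 2) < s → s < t → t < K₀ * A ^ 2 → ∀ x,
      w t x = heatExtension (w s) (t - s) x - oseenDuhamel 1 s w w t x := by
    intro s t hs hst ht x
    have h1 := windowZoom_time_mem hν hM' hsub' (s := s) ⟨hs, hst.trans ht⟩
    have h2 := windowZoom_time_mem hν hM' hsub' (s := t) ⟨hs.trans hst, ht⟩
    exact windowZoom_oseen hν hT hsol hLH hdec hM' h1.1 hst h2.2 x
  have hbd1 : ∀ s ∈ Ioo (-(K₀ * A ^ 2)) (K₀ * A ^ 2), ∀ x, ‖w s x‖ ≤ 1 := fun s hs x =>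
    windowZoom_norm_le_one hν hM' hbd' hs x
  -- ONE gradient bound at rescaled time `0`
  have hgrad : ∀ z : E3, ‖fderiv ℝ (w 0) z‖ ≤ K' := by
    intro z
    have h := hK (A := -(K₀ * A ^ 2)) (B := K₀ * A ^ 2) (u := w) (by linarith) (by linarith) hc hdiv
      hmild hbd1 0 ⟨by linarith, by linarith⟩ z
    rw [norm_iteratedFDeriv_one] at h
    exact h.trans (le_max_left _ _)
  have h0I : (0 : ℝ) ∈ Ioo (-(K₀ * A ^ 2)) (K₀ * A ^ 2) := ⟨by linarith, by linarith⟩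
  have hdiff : ∀ z ∈ (univ : Set E3), DifferentiableAt ℝ (w 0) z := fun z _ =>
    (((windowZoom_isClassical (x₀ := x₀) hν hsol hM' hsub').contDiff_velocity h0I).differentiable
      (by simp)).differentiableAt
  -- mean value inequality from the centre
  have hmvt : ‖w 0 y - w 0 0‖ ≤ K' * ‖y - 0‖ :=
    Convex.norm_image_sub_le_of_norm_fderiv_le hdiff (fun z _ => hgrad z) convex_univ (mem_univ _)
      (mem_univ _)
  rw [sub_zero] at hmvt
  -- the centre value `‖w(0,0)‖ = (AM)⁻¹ ‖u(t₀,x₀)‖ ≥ 1/(2A)`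
  have hcen : 1 / (2 * A) ≤ ‖w 0 0‖ := by
    rw [hwdef, norm_windowZoom_zero_zero hM', hM'def]
    rw [div_le_iff₀ (by positivity)]
    have e : (A * M)⁻¹ * ‖u t₀ x₀‖ * (2 * A) = M⁻¹ * (2 * ‖u t₀ x₀‖) := by field_simp
    rw [e, le_inv_mul_iff₀ hM, mul_one]
    exact hact
  -- on the ball of radius `δ`, `K'‖y‖ < 1/(4A)`
  have hy' : ‖y‖ < δ := by simpa using hy
  have hKy : K' * ‖y‖ < 1 / (4 * A) := by
    have h1 : K' * ‖y‖ ≤ K' * δ := mul_le_mul_of_nonneg_left hy'.le hK'0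
    have h2 : K' * δ < (K' + 1) * δ := by nlinarith
    have h3 : (K' + 1) * δ = 1 / (4 * A) := by rw [hδdef]; field_simp
    linarith
  have htri : ‖w 0 0‖ - ‖w 0 y‖ ≤ ‖w 0 y - w 0 0‖ := by
    rw [← norm_neg (w 0 y - w 0 0), neg_sub]; exact norm_sub_norm_le _ _
  show 1 / (4 * A) < ‖w 0 y‖
  have e : 1 / (2 * A) = 1 / (4 * A) + 1 / (4 * A) := by field_simp; norm_num
  linarith

end HotBall

/-! ### §3c Scale invariance of the top mass -/

section Scaling

variable {ν M' t₀ : ℝ} {u : ℝ → E3 → E3} {x₀ : E3}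

/-- **The level sets of the zoom are rescaled translates of the level sets of `u`**:
`|{y : θ < |w(0,y)|}| = (M'/ν)³ |{x : θM' < |u(t₀,x)|}|` for `w = M'⁻¹ • stPull (ν/M'²) (ν/M') t₀ x₀ u`
(translation invariance and the scaling law of Lebesgue measure). [folklore] -/
theorem volume_levelSet_zoom_zero (hν : 0 < ν) (hM' : 0 < M') (θ : ℝ) :
    volume {y : E3 | θ < ‖(M'⁻¹ • stPull (ν / M' ^ 2) (ν / M') t₀ x₀ u) 0 y‖} =
      ENNReal.ofReal ((M' / ν) ^ 3) * volume {x : E3 | θ * M' < ‖u t₀ x‖} := by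
  have hr : ν / M' ≠ 0 := (div_pos hν hM').ne'
  have hset : {y : E3 | θ < ‖(M'⁻¹ • stPull (ν / M' ^ 2) (ν / M') t₀ x₀ u) 0 y‖} =
      (fun y : E3 => (ν / M') • y) ⁻¹'
        ((fun z : E3 => x₀ + z) ⁻¹' {x : E3 | θ * M' < ‖u t₀ x‖}) := by
    ext y
    simp only [mem_setOf_eq, mem_preimage, smul_stPull_apply, mul_zero, add_zero, norm_smul,
      Real.norm_eq_abs, abs_of_pos (inv_pos.2 hM')]
    rw [inv_mul_eq_div, lt_div_iff₀ hM']
  have hfin : Module.finrank ℝ E3 = 3 := finrank_euclideanSpace_fin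
  rw [hset, Measure.addHaar_preimage_smul volume hr, measure_preimage_add, hfin, ← inv_pow, inv_div,
    abs_of_pos (by positivity)]

/-- **The top mass of the normalised field at a zoom level**: with `ũ = timeRescale ν⁻¹ ν⁻¹ u`,
`s = νt₀` and the level `τ = θM'/ν ≥ 0`,
`topMass (ũ s) τ = (θM'/ν)³ |{x : θM' < |u(t₀,x)|}|`. [folklore] -/
theorem topMass_timeRescale_eq (hν : 0 < ν) {r : ℝ} (hr : 0 ≤ r) (t₀ : ℝ) :
    topMass (timeRescale ν⁻¹ ν⁻¹ u (ν * t₀)) (Real.toNNReal (r / ν)) =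
      ENNReal.ofReal ((r / ν) ^ 3) * volume {x : E3 | r < ‖u t₀ x‖} := by
  have hrν : 0 ≤ r / ν := div_nonneg hr hν.le
  have hcoe : ((Real.toNNReal (r / ν) : ℝ≥0) : ℝ≥0∞) = ENNReal.ofReal (r / ν) := rfl
  have hset : {x : E3 | ((Real.toNNReal (r / ν) : ℝ≥0) : ℝ≥0∞) < ‖timeRescale ν⁻¹ ν⁻¹ u (ν * t₀) x‖ₑ} =
      {x : E3 | r < ‖u t₀ x‖} := by
    ext x
    simp only [mem_setOf_eq]
    rw [hcoe, ← ofReal_norm, ENNReal.ofReal_lt_ofReal_iff_of_nonneg hrν, timeRescale_apply,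
      inv_mul_cancel_left₀ hν.ne', norm_smul, Real.norm_eq_abs, abs_of_pos (inv_pos.2 hν),
      inv_mul_eq_div, div_lt_div_iff_of_pos_right hν]
  unfold topMass
  rw [hset, hcoe, ENNReal.ofReal_pow hrν]

end Scaling

/-! ### §3d Assembly of §3a–§3c -/

/-- **Hot-spot saturation holds** (kernel, standard axioms): every maximal smooth Clay solution from a
decaying datum has top mass `≥ c = (4A)⁻³ |B_δ| > 0` in its normalised field at times arbitrarily close to
`νT` and at arbitrarily high levels. -/
theorem hotSpotSaturation_holds : HotSpotSaturation := by
  intro ν T hν hT u p hmax hLH hdec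
  obtain ⟨A, K₀, hA, hK₀, hwin⟩ := exists_activeWindow hν hT hmax hLH hdec
  obtain ⟨δ, hδ, hball⟩ := exists_hotBall_radius hA hK₀
  have hA0 : 0 < A := one_pos.trans_le hA
  set θ : ℝ := 1 / (4 * A) with hθdef
  have hθ : 0 < θ := by positivity
  refine ⟨ENNReal.ofReal (θ ^ 3) * volume (ball (0 : E3) δ), ?_, fun Λ a haT => ?_⟩
  · exact ENNReal.mul_pos (ENNReal.ofReal_pos.2 (by positivity)).ne' (measure_ball_pos volume 0 hδ).ne'
  -- a window beyond physical time `max (a/ν) 0` at level `M ≥ 4νΛ`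
  have haν : max (a / ν) 0 < T := max_lt (by rw [div_lt_iff₀ hν]; linarith [mul_comm ν T]) hT
  obtain ⟨t, M, x₀, hLM, hM, hsub, hbd, hact⟩ :=
    hwin (4 * ν * Λ) (max (a / ν) 0) (le_max_right _ _) haν
  have hsub0 : Icc (t - K₀ * ν / M ^ 2) (t + K₀ * ν / M ^ 2) ⊆ Ioo 0 T :=
    hsub.trans (Ioo_subset_Ioo_left (le_max_right _ _))
  have hB := hball hν hT hmax.1 hLH hdec hM hsub0 hbd hact
  have hh0 : 0 ≤ K₀ * ν / M ^ 2 := by positivity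
  have ht : t ∈ Ioo (max (a / ν) 0) T := hsub ⟨by linarith, by linarith⟩
  have hM' : 0 < A * M := by positivity
  -- the time `s = νt`, the level `τ = M/(4ν) = θ(AM)/ν`
  have hr : 0 ≤ θ * (A * M) := by positivity
  refine ⟨ν * t, ⟨?_, mul_lt_mul_of_pos_left ht.2 hν⟩, Real.toNNReal (θ * (A * M) / ν), ?_, ?_⟩
  · have : a / ν < t := (le_max_left _ _).trans_lt ht.1
    rw [div_lt_iff₀ hν] at this; linarith [mul_comm t ν]
  · rw [Real.le_toNNReal_iff_coe_le (div_nonneg hr hν.le), le_div_iff₀ hν]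
    have e : θ * (A * M) = M / 4 := by rw [hθdef]; field_simp
    rw [e]; linarith
  · rw [topMass_timeRescale_eq hν hr t, mul_div_assoc, mul_pow,
      ENNReal.ofReal_mul (by positivity), mul_assoc, ← volume_levelSet_zoom_zero hν hM' θ]
    gcongr

/-! ## §4 Headline theorems -/

/-- **HEADLINE 1 (kernel, standard axioms): census criterion row F7vt is EXCLUDED** — a Clay solution
whose normalised field has uniformly vanishing top on a final slab extends smoothly. -/
theorem rowF7vt_holds : Row_F7vt :=
  rowF7vt_of_hotSpot hotSpotSaturation_holds

/-- **HEADLINE 2 (kernel): row F7 IS the top-tameness of weak-`L³`-bounded blow-ups** —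
`TopTameness ↔ Row_F7`. -/
theorem topTameness_iff_rowF7 : TopTameness ↔ Row_F7 :=
  ⟨rowF7_of rowF7vt_holds, topTameness_of_rowF7⟩

/-- **The line concludes the target BY NAME**: `TopTameness → Row_F7`. -/
theorem rowF7_of_topTameness (hTT : TopTameness) : Row_F7 :=
  topTameness_iff_rowF7.1 hTT

end Summit.NavierStokesRegularity.NavierStokesRegularity.Theorems.ScenarioCensus.VanishingTop

/-! ## Census keys -/

namespace Summit.NavierStokesRegularity.NavierStokesRegularity.Theorems.ScenarioCensus

/-- Census row F7vt — (I ∨ II · forward · no symmetry · LH classical solution on `ℝ³ × [0,T)` from a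
rapidly decaying datum whose viscosity-normalised field `ũ = timeRescale ν⁻¹ ν⁻¹ u` has UNIFORMLY
VANISHING TOP `sup_{s ∈ (S₁, νT)} sup_{t ≥ Λ} t³|{|ũ(s)| > t}| → 0` (`Λ → ∞`) on a final slab; no bound on
the weak-`L³` quasinorm): the solution extends smoothly past `T`. BY NAME the line's Prop
`VanishingTop.Row_F7vt`; EXCLUDED-IN-TREE (`row_F7vt_excluded`). -/
def Row_F7vt : Prop := VanishingTop.Row_F7vt

/-- **Census row F7vt is EXCLUDED-IN-TREE** (hot-spot saturation of every blow-up). -/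
theorem row_F7vt_excluded : Row_F7vt := VanishingTop.rowF7vt_holds

/-- The residual of row F7 after the split: top-tameness of weak-`L³`-bounded blow-ups (BY NAME the
line's Prop `VanishingTop.TopTameness`; OPEN — it is equivalent to `Row_F7`). [conjecture] -/
def TopTameness : Prop := VanishingTop.TopTameness

/-- **Row F7 is EXACTLY the top-tameness of weak-`L³`-bounded blow-ups**: `Row_F7 ↔ TopTameness`. -/
theorem row_F7_iff_topTameness : Row_F7 ↔ TopTameness := VanishingTop.topTameness_iff_rowF7.symm

/-- `Row_F7vt ∧ TopTameness → Row_F7` (the split). -/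
theorem row_F7_of_row_F7vt_of_topTameness (hVT : Row_F7vt) (hTT : TopTameness) : Row_F7 :=
  VanishingTop.rowF7_of hVT hTT

end Summit.NavierStokesRegularity.NavierStokesRegularity.Theorems.ScenarioCensus

end
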